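import Literature.NumberTheory.Automorphic.LevelActionTwoLevelHecke
import HarnessLib

/-!
# Hecke operators versus restriction in the coefficients-at-`p` model

Topic `NumberTheory/Automorphic`; namespace `Literature.NumberTheory.Automorphic.LevelAction`;
theorems only (universe `0`), continuing `LevelActionTwoLevelHecke`.  For levels `U' ≤ U ⊆ Δ` and
`α ∈ Δ`, the `LevelAction` analogues of the level-compatibility statements of
`ArithmeticQuotientHeckeTwoLevel` / `HeckeTowerCompatibility` ([KhareThorne2017, §6.2 Lemma 6.5 (2),
§6.3 Lemma 6.10 (proof)]; [ShimuraIATAF1971, Ch. 3, Prop. 3.1]):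

* **`heckeOp_eq_heckeOp_of_bijOn`** — if `U'αU'/U' → UαU/U` is bijective then
  `[U' α U'] m = [U α U] m` on `m ∈ M^U`; hence **`resRepHom_comp_heckeRepHom_of_bijOn`**,
  **`resCohomology_heckeCohomology_of_bijOn`**: `[U'αU'] ∘ res = res ∘ [UαU]` on `H^i`;
* **`heckeOp₂_eq_heckeOp_of_C₁`** (`U α U' = U' α U'` ⇒ `res ∘ [U α U'] = [U' α U']` on `M^{U'}`) and
  **`heckeOp₂_eq_heckeOp_of_C₂`** (stabiliser condition ⇒ `[U α U'] ∘ res = [U α U]` on `M^U`) — the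
  two factorisations through the two-level operator behind "ordinary parts do not depend on the
  level at `p`" (`bijOn_of_comp_eq`);
* `mapsTo_resCohomology_ordinaryPart_of_bijOn` — `res` maps ordinary parts to ordinary parts.

## References

* C. Khare, J. A. Thorne, Amer. J. Math. 139 (2017), §6.2–6.3 (arXiv:1409.7007, held). [KhareThorne2017]
* G. Shimura, *Introduction to the Arithmetic Theory of Automorphic Functions* (1971), Ch. 3. [ShimuraIATAF1971]
-/

noncomputable section

open CategoryTheory

namespace Literature.NumberTheory.Automorphic.LevelAction

/-! ### On an abstract `Δ`-module -/

section Abstract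

variable {R : Type} [CommRing R] {𝒢 : Type} [Group 𝒢] {M : Type} [AddCommGroup M]
  [Module R M] {Δ : Submonoid 𝒢} {θ : Δ →* Module.End R M} {U U' : Subgroup 𝒢}

/-- **`[U' α U'] m = [U α U] m` on `m ∈ M^U`** when the projection `U'αU'/U' → UαU/U` is bijective
(`U' ≤ U ⊆ Δ`, `α ∈ Δ`). [cite: KhareThorne2017, §6.2 Lemma 6.5 (2)] -/
theorem heckeOp_eq_heckeOp_of_bijOn (hU : U.toSubmonoid ≤ Δ) (hU' : U'.toSubmonoid ≤ Δ) (hle : U' ≤ U)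
    {α : 𝒢} (hα : α ∈ Δ)
    (hbij : Set.BijOn (Subgroup.quotientMapOfLE hle) (ArithmeticQuotient.doubleCosetQuot U' α)
      (ArithmeticQuotient.doubleCosetQuot U α))
    {m : M} (hm : m ∈ invariants Δ θ U) :
    heckeOp Δ θ U' α m = heckeOp Δ θ U α m := by
  classical
  by_cases hfin : (ArithmeticQuotient.doubleCosetQuot U' α).Finite
  · have hfin' : (ArithmeticQuotient.doubleCosetQuot U α).Finite := by
      rw [← hbij.image_eq]; exact hfin.image _
    rw [heckeOp_eq_sum hfin, heckeOp_eq_sum hfin', LinearMap.sum_apply, LinearMap.sum_apply]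
    refine Finset.sum_nbij (Subgroup.quotientMapOfLE hle) (fun d hd => ?_) ?_ ?_ fun d hd => ?_
    · rw [Set.Finite.mem_toFinset] at hd ⊢
      exact hbij.mapsTo hd
    · simpa only [Set.Finite.coe_toFinset] using hbij.injOn
    · simpa only [Set.Finite.coe_toFinset] using hbij.surjOn
    · rw [Set.Finite.mem_toFinset] at hd
      have hdΔ : d.out ∈ Δ := out_mem_of_mem_doubleCosetQuot hU' hα hd
      refine (act_out_apply_eq hU hm hdΔ _ ?_).symm
      conv_rhs => rw [← QuotientGroup.out_eq' d]
      rfl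
  · have hfin' : ¬ (ArithmeticQuotient.doubleCosetQuot U α).Finite := fun hf =>
      hfin ((hf.subset hbij.mapsTo.image_subset).of_finite_image hbij.injOn)
    rw [heckeOp_eq_zero_of_infinite hfin, heckeOp_eq_zero_of_infinite hfin']

/-- **`[U α U'] m = [U' α U'] m` on `m ∈ M^{U'}`** when `U α U' = U' α U'` (hypothesis `C₁`:
`U ⊆ U' · (α U' α⁻¹)`). [cite: KhareThorne2017, §6.2 Lemma 6.5 (3)] -/
theorem heckeOp₂_eq_heckeOp_of_C₁ (hle : U' ≤ U) {α : 𝒢}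
    (hC₁ : ∀ l ∈ U, ∃ l' ∈ U', (((l * α : 𝒢)) : 𝒢 ⧸ U') = ((l' * α : 𝒢) : 𝒢 ⧸ U')) (m : M) :
    heckeOp₂ Δ θ U U' α m = heckeOp Δ θ U' α m := by
  classical
  have hS := ArithmeticQuotient.doubleCosetQuot₂_eq_doubleCosetQuot hle hC₁
  by_cases hfin : (ArithmeticQuotient.doubleCosetQuot₂ U U' α).Finite
  · have hfin' : (ArithmeticQuotient.doubleCosetQuot U' α).Finite := by rwa [← hS]
    rw [heckeOp₂_eq_sum hfin, heckeOp_eq_sum hfin']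
    congr 2
    exact Finset.ext fun d => by rw [Set.Finite.mem_toFinset, Set.Finite.mem_toFinset, hS]
  · have hfin' : ¬ (ArithmeticQuotient.doubleCosetQuot U' α).Finite := by rwa [← hS]
    rw [heckeOp₂_eq_zero_of_infinite hfin, heckeOp_eq_zero_of_infinite hfin']

/-- **`[U α U'] m = [U α U] m` on `m ∈ M^U`** under the stabiliser hypothesis `C₂`
(`l α U = α U ⇒ l α U' = α U'` for `l ∈ U`). [cite: KhareThorne2017, §6.3 Lemma 6.10 (proof)] -/
theorem heckeOp₂_eq_heckeOp_of_C₂ (hU : U.toSubmonoid ≤ Δ) (hU' : U'.toSubmonoid ≤ Δ) (hle : U' ≤ U)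
    {α : 𝒢} (hα : α ∈ Δ)
    (hC₂ : ∀ l ∈ U, (((l * α : 𝒢)) : 𝒢 ⧸ U) = (α : 𝒢 ⧸ U) → (((l * α : 𝒢)) : 𝒢 ⧸ U') = (α : 𝒢 ⧸ U'))
    {m : M} (hm : m ∈ invariants Δ θ U) :
    heckeOp₂ Δ θ U U' α m = heckeOp Δ θ U α m := by
  classical
  have hmap := ArithmeticQuotient.mapsTo_quotientMapOfLE_doubleCosetQuot₂ (g := α) hle
  have hinj := ArithmeticQuotient.injOn_quotientMapOfLE_doubleCosetQuot₂ hle hC₂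
  have hsurj := ArithmeticQuotient.surjOn_quotientMapOfLE_doubleCosetQuot₂ (g := α) hle
  by_cases hfin : (ArithmeticQuotient.doubleCosetQuot₂ U U' α).Finite
  · have hfin' : (ArithmeticQuotient.doubleCosetQuot U α).Finite := (hfin.image _).subset hsurj
    rw [heckeOp₂_eq_sum hfin, heckeOp_eq_sum hfin', LinearMap.sum_apply, LinearMap.sum_apply]
    refine Finset.sum_nbij (Subgroup.quotientMapOfLE hle) (fun d hd => ?_) ?_ ?_ fun d hd => ?_
    · rw [Set.Finite.mem_toFinset] at hd ⊢
      exact hmap hd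
    · simpa only [Set.Finite.coe_toFinset] using hinj
    · simpa only [Set.Finite.coe_toFinset] using hsurj
    · rw [Set.Finite.mem_toFinset] at hd
      have hdΔ : d.out ∈ Δ := out_mem_of_mem_doubleCosetQuot₂ hU hU' hα hd
      refine (act_out_apply_eq hU hm hdΔ _ ?_).symm
      conv_rhs => rw [← QuotientGroup.out_eq' d]
      rfl
  · have hfin' : ¬ (ArithmeticQuotient.doubleCosetQuot U α).Finite := fun hf =>
      hfin ((hf.subset hmap.image_subset).of_finite_image hinj)
    rw [heckeOp₂_eq_zero_of_infinite hfin, heckeOp_eq_zero_of_infinite hfin']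

end Abstract

/-! ### On sections and cohomology -/

section Cohomology

variable {R : Type} [CommRing R] {Γ 𝒢 : Type} [Group Γ] [Group 𝒢] (ι : Γ →* 𝒢) (Δ : Submonoid 𝒢)
  {V : Type} [AddCommGroup V] [Module R V] (τ : Δ →* Module.End R V) {U U' : Subgroup 𝒢}
  (hU : U.toSubmonoid ≤ Δ) (hU' : U'.toSubmonoid ≤ Δ) (hle : U' ≤ U)

/-- **`res ≫ [U'αU'] = [UαU] ≫ res`** as morphisms of `Γ`-representations, when `U'αU'/U' → UαU/U` is
bijective. [cite: KhareThorne2017, §6.2 Lemma 6.5 (2)] -/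
theorem resRepHom_comp_heckeRepHom_of_bijOn {α : 𝒢} (hα : α ∈ Δ)
    (hbij : Set.BijOn (Subgroup.quotientMapOfLE hle) (ArithmeticQuotient.doubleCosetQuot U' α)
      (ArithmeticQuotient.doubleCosetQuot U α)) :
    resRepHom ι Δ τ hle ≫ heckeRepHom ι Δ τ U' hU' hα = heckeRepHom ι Δ τ U hU hα ≫ resRepHom ι Δ τ hle := by
  refine Rep.hom_ext (Representation.IntertwiningMap.ext (LinearMap.ext fun f => ?_))
  change (heckeRepHom ι Δ τ U' hU' hα).hom ((resRepHom ι Δ τ hle).hom f) =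
    (resRepHom ι Δ τ hle).hom ((heckeRepHom ι Δ τ U hU hα).hom f)
  refine Subtype.ext ?_
  rw [heckeRepHom_hom_apply_coe, resRepHom_hom_apply_coe, resRepHom_hom_apply_coe, heckeRepHom_hom_apply_coe]
  exact heckeOp_eq_heckeOp_of_bijOn hU hU' hle hα hbij f.2

/-- **`[U'αU'] ∘ res = res ∘ [UαU]` on `H^i`**. [cite: KhareThorne2017, §6.2 Lemma 6.5 (2)] -/
theorem resCohomology_heckeCohomology_of_bijOn {α : 𝒢} (hα : α ∈ Δ)
    (hbij : Set.BijOn (Subgroup.quotientMapOfLE hle) (ArithmeticQuotient.doubleCosetQuot U' α)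
      (ArithmeticQuotient.doubleCosetQuot U α)) (i : ℕ) :
    resCohomology ι Δ τ hle i ≫ groupCohomology.map (MonoidHom.id Γ) (heckeRepHom ι Δ τ U' hU' hα) i =
      groupCohomology.map (MonoidHom.id Γ) (heckeRepHom ι Δ τ U hU hα) i ≫ resCohomology ι Δ τ hle i := by
  rw [resCohomology, ← groupCohomology.map_id_comp, ← groupCohomology.map_id_comp,
    resRepHom_comp_heckeRepHom_of_bijOn ι Δ τ hU hU' hle hα hbij]

/-- The same, applied: `[U'αU'] (res x) = res ([UαU] x)`. [cite: KhareThorne2017, §6.2 Lemma 6.5 (2)] -/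
theorem heckeCohomology_resCohomology_apply_of_bijOn {α : 𝒢} (hα : α ∈ Δ)
    (hbij : Set.BijOn (Subgroup.quotientMapOfLE hle) (ArithmeticQuotient.doubleCosetQuot U' α)
      (ArithmeticQuotient.doubleCosetQuot U α)) (i : ℕ) (x : cohomology ι Δ τ U i) :
    heckeCohomology ι Δ τ U' hU' hα i ((resCohomology ι Δ τ hle i).hom x) =
      (resCohomology ι Δ τ hle i).hom (heckeCohomology ι Δ τ U hU hα i x) := by
  have h' := congrArg ModuleCat.Hom.hom (resCohomology_heckeCohomology_of_bijOn ι Δ τ hU hU' hle hα hbij i)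
  rw [ModuleCat.hom_comp, ModuleCat.hom_comp] at h'
  exact LinearMap.congr_fun h' x

/-- `res` maps `[UαU]`-ordinary vectors to `[U'αU']`-ordinary vectors (bijective cosets).
[cite: KhareThorne2017, §6.3] -/
theorem mapsTo_resCohomology_ordinaryPart_of_bijOn {α : 𝒢} (hα : α ∈ Δ)
    (hbij : Set.BijOn (Subgroup.quotientMapOfLE hle) (ArithmeticQuotient.doubleCosetQuot U' α)
      (ArithmeticQuotient.doubleCosetQuot U α)) (i : ℕ) :
    Set.MapsTo (resCohomology ι Δ τ hle i).hom
      (⨅ n : ℕ, LinearMap.range (heckeCohomology ι Δ τ U hU hα i ^ n) : Submodule R (cohomology ι Δ τ U i))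
      (⨅ n : ℕ, LinearMap.range (heckeCohomology ι Δ τ U' hU' hα i ^ n) : Submodule R (cohomology ι Δ τ U' i)) := by
  intro x hx
  rw [SetLike.mem_coe, Submodule.mem_iInf] at hx ⊢
  intro n
  obtain ⟨y, hy⟩ := LinearMap.mem_range.1 (hx n)
  refine LinearMap.mem_range.2 ⟨(resCohomology ι Δ τ hle i).hom y, ?_⟩
  rw [← hy]
  clear hy hx
  induction n generalizing y with
  | zero => rfl
  | succ n ih =>
    rw [pow_succ, pow_succ, Module.End.mul_apply, Module.End.mul_apply,
      heckeCohomology_resCohomology_apply_of_bijOn ι Δ τ hU hU' hle hα hbij i, ih]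

end Cohomology

end Literature.NumberTheory.Automorphic.LevelAction
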